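import Summits.ResolutionOfSingularities.ResolutionOfSingularities.Theorems.HilbertSamuelEliminationSigmaMaxModificationsCorridor3WLadderMovingTwoDefs
import Literature.AlgebraicGeometry.CossartJannsenSaito2020.KeyTheoremsLocal
import HarnessLib

/-!
# [OURS · L1 W4.2] Row `stub_Wlow3M_two` in the UNITS MODEL OF RECORD (b) — DEFINITIONS: the characteristic-free unit-wise
# LOCALISED key theorem and extraction (crux chain w42, line `w_ladder` v7; plan-1 RULINGS v3.10-1 (A) «units model of record =
# (b) unit-wise LOCALIZED chains», v3.11 (2)(b) «ONE extraction serves the char row and the p = 2 row iff U-seg lands in the Loc form»)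

Stub worker res-L1-w42-stub-3 (gen 3). Companion of `…Corridor3WLadderMovingTwoDefs` (model (a′), single tower:
`KeyTheorem640_geomDir_isolated` ↔ `KeyTheorem640_isolated`, `UnitTowerExtractionFreeM`). In model (b) the (F1) row consumes
`KeyTheorem640_char_localized_isolated` (F-04c, `KeyTheoremsLocal.lean`) through `UnitTowerExtractionLocAtQM p Q`
(`…SegmentsDefs`, stub-1), whose conclusion carries `CharHypothesis ((T 0).X 0) (pt 0)` — unbuildable at `p = 2`, `dim X = 3`.
Stub-1's `unitTowerExtractionLocFree_of_recognition` (p51xxxx, `…SegmentsExtractFree`) already delivers the extraction WITHOUT that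
conjunct from the recognition row `Seg.UnitRecognitionAtQM p Q`; this file names the two model-(b) objects of the characteristic-2 row:

* `KeyTheorem640_localized_isolated` — OURS CLAIM: `KeyTheorem640_char_localized_isolated` with the characteristic hypothesis (F1)
  `CharHypothesis ((T 0).X 0) (pt 0)` REMOVED («CJS Thm. 6.40 for unit-wise localised chains of fundamental units with isolated initial
  points, in EVERY characteristic»). As for the single-tower carrier, (F1♯) `GeomDirHypothesis` is automatic at a unit start
  (`ē = 2`), so this char-free form IS the (F1♯) form; status: conditional = «print + 2.14♯ + memo BETA-UNITS-SCOPE» (every use of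
  Thm. 3.14 in Chs. 12–14 is at a point with `ē − dim D ≤ 2`); NOT a statement of LNM 2270. The model-(b) member of the residue R_β.
* `UnitTowerExtractionLocFreeM p` — the extraction in model (b) over ALL maximal origins with the `CharHypothesis` conjunct dropped from
  the conclusion (= the conclusion of stub-1's `unitTowerExtractionLocFree_of_recognition` at `Q = ⊤`); OURS construction, discharged
  modulo the recognition row in the companion `…MovingTwoLoc`.

Everything here is a DEFINITION; the reductions are in `…Corridor3WLadderMovingTwoLoc.lean`. OURS (cell res-hironaka, slot W4.2); NOT
statements of the manuscript [Hironaka2017] nor of [CossartJannsenSaito2020]; AI-drafted, weaker than expert review.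
References: CJS LNM 2270 Def. 6.38, Def. 6.39, Thm. 6.40, p. 107, Thm. 13.7, Thm. 14.4 [CossartJannsenSaito2020]; tree
`KeyTheoremsLocal.lean` (`IsLocalizedChainOfFundamentalUnits`, `KeyTheorem640_char_localized_isolated`), `…SegmentsDefs` (stub-1).
-/

noncomputable section

-- plan-1/idea-2 module setting kept verbatim (namespace `…Corridor3.Moving` re-enters `…Corridor3`)
set_option linter.dupNamespace false

open CategoryTheory AlgebraicGeometry TopologicalSpace IsLocalRing
open Summit.ResolutionOfSingularities.ResolutionOfSingularities.Theorems.CampaignW42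
open Literature.AlgebraicGeometry.Resolution Literature.RingTheory.HilbertSamuel
open Literature.AlgebraicGeometry.CossartJannsenSaito2020
open Summit.ResolutionOfSingularities.ResolutionOfSingularities.Theses.HilbertSamuelElimination
open Summit.ResolutionOfSingularities.ResolutionOfSingularities.Theorems.SigmaMaxModificationsCorridor3

namespace Summit.ResolutionOfSingularities.ResolutionOfSingularities.Theorems.SigmaMaxModificationsCorridor3.Moving

universe u

/-- [OURS · L1 W4.2] replaces the role of CJS Thm. 6.40 for UNIT-WISE LOCALISED chains of fundamental units (model (b)) in the row
`stub_Wlow3M_two` (p = 2, dim X = 3): the typed `KeyTheorem640_char_localized_isolated` (F-04c) with its characteristic hypothesis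
`CharHypothesis ((T 0).X 0) (pt 0)` REMOVED — «there is no infinite unit-wise localised chain of fundamental units (Def. 6.38/6.39,
boundary-free, `IsLocalizedChainOfFundamentalUnits`) in the key setting all of whose initial points are isolated in the Hilbert–Samuel
locus of their (local) initial stage», in every characteristic. STRONGER than print (the source proves Thm. 6.40 under (F1)); status
CONDITIONAL: (F1♯) is automatic at unit starts (`ē = 2`), and by the memo BETA-UNITS-SCOPE every use of Thm. 3.14 in the printed proof
(Chs. 12–14) is at a point with `ē − dim D ≤ 2`, where 2.14♯ supplies it — «print + 2.14♯ + memo», to be discharged (or refuted) by a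
page-by-page re-verification; consumed BY NAME as a hypothesis until then. OURS node; not a citation of print; not asserted. -/
def KeyTheorem640_localized_isolated : Prop :=
  ∀ (T : ℕ → BlowupTower.{u}) (N : ℕ) (len : ℕ → ℕ) (pt : ∀ i, (T i).X 0) (tpt : ∀ i, (T i).X (len i)),
    KeySetting (T 0) N →
    IsLocalizedChainOfFundamentalUnits T N len pt tpt →
    (∀ i, @IsIsolatedInHSMaxLocus ((T i).X 0) ((T i).ln 0) N (pt i)) → False

/-- [OURS · L1 W4.2] **The unit-tower extraction in model (b), ALL maximal origins, characteristic-free conclusion** (= stub-1's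
`UnitTowerExtractionLocAtQM p ⊤` with the conjunct `CharHypothesis ((T 0).X 0) (pt 0)` DROPPED): from a maximal origin of characteristic
`p` at level `3`, a MOVING chain of grade `ē ≤ 2`, isolated in the Hilbert–Samuel locus infinitely often and with `(e, ē) = (2, 2)` at
every isolated stage, yields a unit-wise localised chain of fundamental units with `KeySetting (T 0) 3` and every initial point isolated —
the antecedent of `KeyTheorem640_localized_isolated`. Buildable at `p = 2`, `dim X = 3`; discharged modulo the recognition row
`Seg.UnitRecognitionAtQM p ⊤` by stub-1's `unitTowerExtractionLocFree_of_recognition` (companion file).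
[cite: CossartJannsenSaito2020, Def. 6.38, Def. 6.39, p. 107] -/
def UnitTowerExtractionLocFreeM (p : ℕ) : Prop :=
  ∀ (R : ∀ S : Scheme.{0}, CentreSeq S → Prop), OracleFunctional R → OracleAdmissible R →
  ∀ (ν : ℕ → ℕ) (X : Scheme.{0}) [IsLocallyNoetherian X] (x : X), IsMaximalOrigin p 3 ν X x →
  ∀ c : ℕ → MarkedStage.{0}, Reaches R 3 ν (MarkedStage.init X x) (c 0) →
    (∀ n, CanonicalNearStep R 3 ν (c n) (c (n + 1))) → (∀ n, (c n).geomDirDim ≤ 2) →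
    (∀ n, ∃ m, n ≤ m ∧ (c m).IsBlownUp R 3 ν) → (∀ n, ∃ m, n ≤ m ∧ Iso 3 (c m)) →
    (∀ n, Iso 3 (c n) → dirDim (c n) = 2 ∧ (c n).geomDirDim = 2) →
    ∃ (T : ℕ → BlowupTower.{0}) (len : ℕ → ℕ) (pt : ∀ i, (T i).X 0) (tpt : ∀ i, (T i).X (len i)),
      IsLocalizedChainOfFundamentalUnits T 3 len pt tpt ∧ KeySetting (T 0) 3 ∧
      ∀ i, @IsIsolatedInHSMaxLocus ((T i).X 0) ((T i).ln 0) 3 (pt i)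

end Summit.ResolutionOfSingularities.ResolutionOfSingularities.Theorems.SigmaMaxModificationsCorridor3.Moving

end
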